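/-
Copyright (c) 2026 the pub-hodgecm-mathlib formalisation cell (harness21).  Prover seat hodgecm-mathlib-F0P3a-p01 (g17): road «S3-ram» (LEAD F0P3a-plan; architect A-p16;
owner F0P3a-p06), the (a2) JUNCTION (J★) of crux H413 — J-PACK v2 assembly pen; 2026-09-02.
-/
import Literature.NumberTheory.Automorphic.UnitaryLatticeTreeFixedGrandchildrenSliceCountRamified   -- ★ G3⁺ (F0P2-p06): GC currency, root, tokens
import Literature.NumberTheory.Automorphic.UnitaryLatticeTreeTypeTwoParent                     -- ★ `scaleLattice_one`
import Literature.NumberTheory.Automorphic.UnitaryLatticeTreeFixedVertex                        -- ★ `scaleLattice_scaleLattice`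
import Literature.NumberTheory.Automorphic.UnitaryLatticeTreeFramesOfInvolution                  -- ★ `isTree_latticeGraph_three_of_neg`
import Literature.NumberTheory.Automorphic.UnitaryLatticeTreeFixedGrandchildFrameRamified          -- ★ FILE L (F0P2-p01)
import Literature.NumberTheory.Automorphic.UnitaryLatticeTreeTypeTwoGram                          -- ★ `isIntMatrix_mul`
import Literature.NumberTheory.Automorphic.UnitaryLatticeTreeNilpotencyTokenOfDepths               -- ★ ROW-N (F0P3-p03)
import Literature.NumberTheory.Automorphic.UnitaryLatticeTreeRankOneVertexOneClassRamified         -- ★ ROW-1C (F0P3a-p05)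
import Literature.NumberTheory.Automorphic.UnitaryLatticeTreeClassConstantDictionaryRamified        -- ★ 1C-TRANS + SGN-DICT (F0P3a-p05)
import Literature.NumberTheory.Automorphic.UnitaryLatticeTreeRootGrandchildLabelsRamified          -- ★ ROW-ROOT-LBL (F0P3a-p04)
import Literature.NumberTheory.Automorphic.UnitaryLatticeTreeRegionUpClosedRamified                 -- ★ S1 + row-free orientation (F0P3-p04)
import Literature.NumberTheory.Rogawski1990.DepthZeroKappaTransferTypeOneRamifiedTreeInduction      -- ★ ENGINE (F0P3a-p01 (g16)); brings ★ G1 `exists_rooted_parent`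
import Literature.NumberTheory.Automorphic.UnitaryLatticeTreeFixedChildrenShallowerRamified        -- ★ `lev_mono_of_le` (F0P2-p01)
import Literature.NumberTheory.Automorphic.UnitaryLatticeTreeEigenframeCharpoly                    -- ★ `charpoly_of_eigenframe` (A-p16)
import Literature.NumberTheory.Automorphic.UnitaryLatticeTreeOrientationOfRowsRamified             -- ★ L2 `dep_lt_and_exists_orientation` (F0P2-p01)
import HarnessLib

/-!
# The ramified type-(1) `κ`-orbital integral, JUNCTION I: the concrete labels of the fixed lattice tree and the strata dictionary

Topic `NumberTheory/Rogawski1990`; namespace `Literature.NumberTheory.Rogawski1990.TypeOneRamifiedJunction`.  THEOREMS ONLY (no definition, no instance, no notation, no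
named fact, no `sorry`); kernel lane `--supports stmt-HodgeConjecture-24833`.  Cell `pub/hodgecm-mathlib` (D-0151), crux H413; road «S3-ram» (count-neutral), P-1-ram organ
A′ (ii) (a2): THE JUNCTION between the ★ local laws of the fixed labelled lattice tree of a ramified type-(1) literal (J-PACK v2 rows, landed by F0P2-p01 ∕ F0P2-p06 ∕ F0P3-p03 ∕
F0P3-p04 ∕ F0P3a-p04 ∕ F0P3a-p05 ∕ F0P2-p02 ∕ LH4) and the ★ tree-induction ENGINE (F0P3a-p01 (g16), ED. 3 F0P3a-p02): everything runs in the `J₀`-MODEL (root `r₀ = 𝒪³`,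
`γ ∈ K₀` the literal normalised by its middle eigenvalue and conjugated by the ★ `GL₃(𝒪)` frame of the literal's diagonal form), with the CONCRETE LABELS
`dep w = Nat.findGreatest (e ↦ (γ−1)w ⊆ ϖ^e w) B`, `rk w = if (γ−1)²w ⊆ ϖ^(2·dep w+1)·w then 1 else 2`, `cl w = if CLS[w](dep w, c₁) then 1 else −1` — characterised abstractly in
the statements (`hdep hrk hcl`) in the engine's own binder style so that every lemma is instantiated by `rfl`.

* §1 helpers: `lev_zero_of_fix` (the level-`0` token at a fixed vertex), `le_findGreatest_lev_iff` (the `Nat.findGreatest` depth characterisation), `ncard_fixed_selfDual_sep_eq`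
  (vertex-set ↔ lattice-set counts); the monotone token ★ `lev_mono_of_le` and ★ `charpoly_of_eigenframe`, ★ L2 `dep_lt_and_exists_orientation` (F0P2-p01) are cited by name.
* §2 `hstr_of_labels` (L1): the engine's strata dictionary `hstr` for the concrete labels (over ★ ROW-1C `class_xor_class_mul_of_fixed_selfDual_rankOne` and ★ ROW-N).
HONEST LABEL: HC_CM is proved only modulo the 2 remaining named inputs (hLiu418 24832, h413 24833) until rung 0 closes; nothing printed is asserted here (lattice
bookkeeping over ★ results); «S3-ram» is Literature seeding, count-neutral.

## References
* [Kottwitz1986] R. E. Kottwitz, *Base change for unit elements of Hecke algebras*, Compositio Math. 60 (1986), §3 (counting fixed lattices shell by shell).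
* [Rogawski1990] J. D. Rogawski, *Automorphic Representations of Unitary Groups in Three Variables*, Ann. of Math. Stud. 123 (1990), §4.9 pp. 54–56 (the strata of the
  ramified orbital integrals), Prop. 4.9.1.
* [LabesseLanglands1979] J.-P. Labesse, R. P. Langlands, *L-indistinguishability for SL(2)*, Canad. J. Math. 31 (1979), §2 (κ-signed counts over the four literals).
* [BruhatTits1972] F. Bruhat, J. Tits, *Groupes réductifs sur un corps local I*, Publ. Math. IHÉS 41 (1972), §10 (lattice models of the building).
* [Serre1980Trees] J.-P. Serre, *Trees* (1980), I.2.3, II.1.1.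
-/

set_option autoImplicit false

noncomputable section

open scoped Valued WithZero Matrix MatrixGroups
open Polynomial Classical SimpleGraph
open Literature.Combinatorics.SimpleGraph.TreeLayers
open Literature.NumberTheory.Automorphic Literature.NumberTheory.Automorphic.HermitianLattice Literature.NumberTheory.Automorphic.UnitaryLatticeTree

namespace Literature.NumberTheory.Rogawski1990.TypeOneRamifiedJunction

variable {K : Type*} [Field K] [Valued K ℤᵐ⁰] {σ : K →+* K} {ϖ : K}

/-! ## Assembly helpers (F0P3a-p01 (g17)): the depth token is monotone, holds at level 0 on fixed vertices; `Nat.findGreatest` characterisation; vertex-set ↔ lattice-set counts -/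

/-- At a `γ`-fixed vertex the level-`0` token holds: `(γ−1)M ⊆ M = ϖ^0 M`. [cite: Serre1980Trees, II.1.1] -/
theorem lev_zero_of_fix {γ : unitaryGroupOfForm σ ((StdForm.antidiagonal 3).over K)} {w : {M : Submodule 𝒪[K] (Fin 3 → K) // IsVertex σ ϖ ((StdForm.antidiagonal 3).over K) M}} (hfix : latticeGraphIso σ ϖ ((StdForm.antidiagonal 3).over K) γ w = w) : w.1.map ((Matrix.toLin' (((γ : GL (Fin 3) K) : Matrix (Fin 3) (Fin 3) K) - 1)).restrictScalars 𝒪[K]) ≤ scaleLattice (ϖ ^ 0) w.1 := by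
  have hfix' : mapGL (γ : GL (Fin 3) K) w.1 = w.1 := by rw [← latticeGraphIso_apply_val (ϖ := ϖ), hfix]
  rw [pow_zero, scaleLattice_one, Submodule.map_le_iff_le_comap]
  intro x hx
  rw [Submodule.mem_comap, LinearMap.restrictScalars_apply, Matrix.toLin'_apply, Matrix.sub_mulVec, Matrix.one_mulVec]
  refine Submodule.sub_mem _ ?_ hx
  have : (((γ : GL (Fin 3) K) : Matrix (Fin 3) (Fin 3) K)).mulVec x ∈ mapGL (γ : GL (Fin 3) K) w.1 :=
    Submodule.mem_map_of_mem (f := (Matrix.toLin' ((γ : GL (Fin 3) K) : Matrix (Fin 3) (Fin 3) K)).restrictScalars 𝒪[K]) hx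
  rwa [hfix'] at this

/-- The concrete depth `dep w = Nat.findGreatest (LEV[w] ϖ^·) B` is characterised by `e ≤ dep w ↔ e ≤ B ∧ LEV[w](ϖ^e)` at every fixed vertex. [cite: Kottwitz1986, §3] -/
theorem le_findGreatest_lev_iff (hϖ1 : Valued.v ϖ ≤ 1) {γ : unitaryGroupOfForm σ ((StdForm.antidiagonal 3).over K)} (B : ℕ) {w : {M : Submodule 𝒪[K] (Fin 3 → K) // IsVertex σ ϖ ((StdForm.antidiagonal 3).over K) M}} (hfix : latticeGraphIso σ ϖ ((StdForm.antidiagonal 3).over K) γ w = w) (e : ℕ) :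
    e ≤ Nat.findGreatest (fun e => w.1.map ((Matrix.toLin' (((γ : GL (Fin 3) K) : Matrix (Fin 3) (Fin 3) K) - 1)).restrictScalars 𝒪[K]) ≤ scaleLattice (ϖ ^ e) w.1) B ↔ e ≤ B ∧ w.1.map ((Matrix.toLin' (((γ : GL (Fin 3) K) : Matrix (Fin 3) (Fin 3) K) - 1)).restrictScalars 𝒪[K]) ≤ scaleLattice (ϖ ^ e) w.1 := by
  constructor
  · intro he
    refine ⟨he.trans (Nat.findGreatest_le B), ?_⟩
    have hspec : w.1.map ((Matrix.toLin' (((γ : GL (Fin 3) K) : Matrix (Fin 3) (Fin 3) K) - 1)).restrictScalars 𝒪[K]) ≤ scaleLattice (ϖ ^ Nat.findGreatest (fun e => w.1.map ((Matrix.toLin' (((γ : GL (Fin 3) K) : Matrix (Fin 3) (Fin 3) K) - 1)).restrictScalars 𝒪[K]) ≤ scaleLattice (ϖ ^ e) w.1) B) w.1 :=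
      Nat.findGreatest_spec (P := fun e => w.1.map ((Matrix.toLin' (((γ : GL (Fin 3) K) : Matrix (Fin 3) (Fin 3) K) - 1)).restrictScalars 𝒪[K]) ≤ scaleLattice (ϖ ^ e) w.1) (Nat.zero_le B) (lev_zero_of_fix hfix)
    exact lev_mono_of_le hϖ1 he hspec
  · rintro ⟨heB, hlev⟩
    exact Nat.le_findGreatest (P := fun e => w.1.map ((Matrix.toLin' (((γ : GL (Fin 3) K) : Matrix (Fin 3) (Fin 3) K) - 1)).restrictScalars 𝒪[K]) ≤ scaleLattice (ϖ ^ e) w.1) heB hlev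

/-- Counting fixed self-dual vertices with a label = counting the underlying lattices (the vertex subtype is injected by `Subtype.val`; a self-dual lattice is a vertex).
[cite: BruhatTits1972, §10] -/
theorem ncard_fixed_selfDual_sep_eq {γ : unitaryGroupOfForm σ ((StdForm.antidiagonal 3).over K)} (P : Submodule 𝒪[K] (Fin 3 → K) → Prop) :
    ({v | latticeGraphIso σ ϖ ((StdForm.antidiagonal 3).over K) γ v = v} ∩ {w : {M : Submodule 𝒪[K] (Fin 3 → K) // IsVertex σ ϖ ((StdForm.antidiagonal 3).over K) M} | IsSelfDualLattice σ ϖ ((StdForm.antidiagonal 3).over K) w.1 ∧ P w.1}).ncard =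
      {M : Submodule 𝒪[K] (Fin 3 → K) | IsSelfDualLattice σ ϖ ((StdForm.antidiagonal 3).over K) M ∧ mapGL (γ : GL (Fin 3) K) M = M ∧ P M}.ncard := by
  have himage : {M : Submodule 𝒪[K] (Fin 3 → K) | IsSelfDualLattice σ ϖ ((StdForm.antidiagonal 3).over K) M ∧ mapGL (γ : GL (Fin 3) K) M = M ∧ P M} =
      Subtype.val '' ({v | latticeGraphIso σ ϖ ((StdForm.antidiagonal 3).over K) γ v = v} ∩ {w : {M : Submodule 𝒪[K] (Fin 3 → K) // IsVertex σ ϖ ((StdForm.antidiagonal 3).over K) M} | IsSelfDualLattice σ ϖ ((StdForm.antidiagonal 3).over K) w.1 ∧ P w.1}) := by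
    ext M
    simp only [Set.mem_setOf_eq, Set.mem_image, Set.mem_inter_iff]
    constructor
    · rintro ⟨hsd, hfix, hP⟩
      refine ⟨⟨M, 0, hsd⟩, ⟨?_, hsd, hP⟩, rfl⟩
      exact Subtype.ext (by rw [latticeGraphIso_apply_val]; exact hfix)
    · rintro ⟨w, ⟨hfix, hsd, hP⟩, rfl⟩
      exact ⟨hsd, by rw [← latticeGraphIso_apply_val (ϖ := ϖ), hfix], hP⟩
  rw [himage, Set.ncard_image_of_injective _ Subtype.val_injective]

/-- L1 (assembly pen): the engine's `hstr` for the concrete labels (abstractly characterised by `hdep hrk hcl`) — uses ROW-1C and ROW-N at depth 1. [cite: Kottwitz1986, §3] [cite: Rogawski1990, §4.9 pp. 54–56] -/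
theorem hstr_of_labels (hσ : ∀ x, σ (σ x) = x) (hvσ : ∀ a, Valued.v (σ a) = Valued.v a) (hσϖ : σ ϖ = -ϖ)
    (hϖ : Valued.v ϖ = WithZero.exp (-1 : ℤ)) (hres : ∀ x : K, Valued.v x ≤ 1 → Valued.v (σ x - x) < 1) (h2 : Valued.v (2 : K) = 1) [Finite 𝓀[K]]
    (_hT : (latticeGraph σ ϖ ((StdForm.antidiagonal 3).over K)).IsTree)
    {γ : unitaryGroupOfForm σ ((StdForm.antidiagonal 3).over K)} (hγ0 : γ ∈ unitaryInt σ ((StdForm.antidiagonal 3).over K))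
    (A : GL (Fin 3) K) (_hA : IsIntMatrix (A : Matrix (Fin 3) (Fin 3) K)) (_hA' : IsIntMatrix ((A⁻¹ : GL (Fin 3) K) : Matrix (Fin 3) (Fin 3) K))
    (s : Fin 3 → K) (hs1 : s 1 = 1)
    (hγA : ((γ : GL (Fin 3) K) : Matrix (Fin 3) (Fin 3) K) = (A : Matrix (Fin 3) (Fin 3) K) * Matrix.diagonal s * ((A⁻¹ : GL (Fin 3) K) : Matrix (Fin 3) (Fin 3) K))
    (D : ℕ) (hD2 : 2 ≤ D) (heD : ∀ i, Valued.v (s i - 1) ≤ Valued.v ϖ ^ D)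
    (c₁ ε : K) (hc₁ : Valued.v c₁ = 1) (hεv : Valued.v ε = 1) (hε : ∀ z : K, Valued.v z ≤ 1 → Valued.v (z ^ 2 - ε) = 1)
    (B : ℕ) (dep rk : {M : Submodule 𝒪[K] (Fin 3 → K) // IsVertex σ ϖ ((StdForm.antidiagonal 3).over K) M} → ℕ) (cl : {M : Submodule 𝒪[K] (Fin 3 → K) // IsVertex σ ϖ ((StdForm.antidiagonal 3).over K) M} → ℤ)
    (hdep : ∀ w : {M : Submodule 𝒪[K] (Fin 3 → K) // IsVertex σ ϖ ((StdForm.antidiagonal 3).over K) M}, latticeGraphIso σ ϖ ((StdForm.antidiagonal 3).over K) γ w = w → ∀ e, e ≤ dep w ↔ e ≤ B ∧ w.1.map ((Matrix.toLin' (((γ : GL (Fin 3) K) : Matrix (Fin 3) (Fin 3) K) - 1)).restrictScalars 𝒪[K]) ≤ scaleLattice (ϖ ^ e) w.1)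
    (hrk : ∀ w : {M : Submodule 𝒪[K] (Fin 3 → K) // IsVertex σ ϖ ((StdForm.antidiagonal 3).over K) M}, rk w = if w.1.map ((Matrix.toLin' ((((γ : GL (Fin 3) K) : Matrix (Fin 3) (Fin 3) K) - 1) ^ 2)).restrictScalars 𝒪[K]) ≤ scaleLattice (ϖ ^ (2 * dep w + 1)) w.1 then 1 else 2)
    (hcl : ∀ w : {M : Submodule 𝒪[K] (Fin 3 → K) // IsVertex σ ϖ ((StdForm.antidiagonal 3).over K) M}, cl w = if (∃ y ∈ w.1, ∃ a : K, Valued.v a = 1 ∧ Valued.v ((ϖ ^ (dep w))⁻¹ * pairing σ ((StdForm.antidiagonal 3).over K) y ((((γ : GL (Fin 3) K) : Matrix (Fin 3) (Fin 3) K) - 1) *ᵥ y) - (c₁) * a ^ 2) < 1) then (1 : ℤ) else -1)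
    (hB : 2 ≤ B)
    (str : Fin 5 → {M : Submodule 𝒪[K] (Fin 3 → K) // IsVertex σ ϖ ((StdForm.antidiagonal 3).over K) M} → Prop)
    (hstr0 : ∀ w, str 0 w ↔ ¬ w.1.map ((Matrix.toLin' (((γ : GL (Fin 3) K) : Matrix (Fin 3) (Fin 3) K) - 1)).restrictScalars 𝒪[K]) ≤ scaleLattice (ϖ) w.1)
    (hstr1 : ∀ w, str 1 w ↔ (w.1.map ((Matrix.toLin' (((γ : GL (Fin 3) K) : Matrix (Fin 3) (Fin 3) K) - 1)).restrictScalars 𝒪[K]) ≤ scaleLattice (ϖ) w.1 ∧ ¬ w.1.map ((Matrix.toLin' (((γ : GL (Fin 3) K) : Matrix (Fin 3) (Fin 3) K) - 1)).restrictScalars 𝒪[K]) ≤ scaleLattice (ϖ ^ 2) w.1 ∧ ¬ w.1.map ((Matrix.toLin' ((((γ : GL (Fin 3) K) : Matrix (Fin 3) (Fin 3) K) - 1) ^ 2)).restrictScalars 𝒪[K]) ≤ scaleLattice (ϖ ^ 3) w.1))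
    (hstr2 : ∀ w, str 2 w ↔ (w.1.map ((Matrix.toLin' (((γ : GL (Fin 3) K) : Matrix (Fin 3) (Fin 3) K) - 1)).restrictScalars 𝒪[K]) ≤ scaleLattice (ϖ) w.1 ∧ ¬ w.1.map ((Matrix.toLin' (((γ : GL (Fin 3) K) : Matrix (Fin 3) (Fin 3) K) - 1)).restrictScalars 𝒪[K]) ≤ scaleLattice (ϖ ^ 2) w.1 ∧ w.1.map ((Matrix.toLin' ((((γ : GL (Fin 3) K) : Matrix (Fin 3) (Fin 3) K) - 1) ^ 2)).restrictScalars 𝒪[K]) ≤ scaleLattice (ϖ ^ 3) w.1 ∧ ∃ y ∈ w.1, ∃ a : K, Valued.v a = 1 ∧ Valued.v (ϖ⁻¹ * pairing σ ((StdForm.antidiagonal 3).over K) y ((((γ : GL (Fin 3) K) : Matrix (Fin 3) (Fin 3) K) - 1) *ᵥ y) - c₁ * a ^ 2) < 1))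
    (hstr3 : ∀ w, str 3 w ↔ (w.1.map ((Matrix.toLin' (((γ : GL (Fin 3) K) : Matrix (Fin 3) (Fin 3) K) - 1)).restrictScalars 𝒪[K]) ≤ scaleLattice (ϖ) w.1 ∧ ¬ w.1.map ((Matrix.toLin' (((γ : GL (Fin 3) K) : Matrix (Fin 3) (Fin 3) K) - 1)).restrictScalars 𝒪[K]) ≤ scaleLattice (ϖ ^ 2) w.1 ∧ w.1.map ((Matrix.toLin' ((((γ : GL (Fin 3) K) : Matrix (Fin 3) (Fin 3) K) - 1) ^ 2)).restrictScalars 𝒪[K]) ≤ scaleLattice (ϖ ^ 3) w.1 ∧ ∃ y ∈ w.1, ∃ a : K, Valued.v a = 1 ∧ Valued.v (ϖ⁻¹ * pairing σ ((StdForm.antidiagonal 3).over K) y ((((γ : GL (Fin 3) K) : Matrix (Fin 3) (Fin 3) K) - 1) *ᵥ y) - (c₁ * ε) * a ^ 2) < 1))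
    (hstr4 : ∀ w, str 4 w ↔ w.1.map ((Matrix.toLin' (((γ : GL (Fin 3) K) : Matrix (Fin 3) (Fin 3) K) - 1)).restrictScalars 𝒪[K]) ≤ scaleLattice (ϖ ^ 2) w.1)
    (w : {M : Submodule 𝒪[K] (Fin 3 → K) // IsVertex σ ϖ ((StdForm.antidiagonal 3).over K) M}) (hw : IsSelfDualLattice σ ϖ ((StdForm.antidiagonal 3).over K) w.1) (hfix : latticeGraphIso σ ϖ ((StdForm.antidiagonal 3).over K) γ w = w) :
    (str 0 w ↔ dep w = 0) ∧ (str 1 w ↔ dep w = 1 ∧ rk w = 2) ∧ (str 2 w ↔ dep w = 1 ∧ rk w = 1 ∧ cl w = 1) ∧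
      (str 3 w ↔ dep w = 1 ∧ rk w = 1 ∧ cl w = -1) ∧ (str 4 w ↔ 2 ≤ dep w) := by
  have hϖ1 : Valued.v ϖ ≤ 1 := by rw [hϖ, ← WithZero.exp_zero]; exact WithZero.exp_le_exp.2 (by norm_num)
  have hB1 : 1 ≤ B := by omega
  -- depth characterisations
  have h1 : 1 ≤ dep w ↔ w.1.map ((Matrix.toLin' (((γ : GL (Fin 3) K) : Matrix (Fin 3) (Fin 3) K) - 1)).restrictScalars 𝒪[K]) ≤ scaleLattice (ϖ) w.1 := by
    rw [hdep w hfix 1, pow_one]; exact ⟨fun h => h.2, fun h => ⟨hB1, h⟩⟩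
  have hge2 : 2 ≤ dep w ↔ w.1.map ((Matrix.toLin' (((γ : GL (Fin 3) K) : Matrix (Fin 3) (Fin 3) K) - 1)).restrictScalars 𝒪[K]) ≤ scaleLattice (ϖ ^ 2) w.1 := by
    rw [hdep w hfix 2]; exact ⟨fun h => h.2, fun h => ⟨hB, h⟩⟩
  have hd0 : dep w = 0 ↔ ¬ w.1.map ((Matrix.toLin' (((γ : GL (Fin 3) K) : Matrix (Fin 3) (Fin 3) K) - 1)).restrictScalars 𝒪[K]) ≤ scaleLattice (ϖ) w.1 := by rw [← h1]; omega
  have hd1 : dep w = 1 ↔ w.1.map ((Matrix.toLin' (((γ : GL (Fin 3) K) : Matrix (Fin 3) (Fin 3) K) - 1)).restrictScalars 𝒪[K]) ≤ scaleLattice (ϖ) w.1 ∧ ¬ w.1.map ((Matrix.toLin' (((γ : GL (Fin 3) K) : Matrix (Fin 3) (Fin 3) K) - 1)).restrictScalars 𝒪[K]) ≤ scaleLattice (ϖ ^ 2) w.1 := by rw [← h1, ← hge2]; omega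
  -- rank and class at depth one
  have hrk1 : dep w = 1 → (rk w = 2 ↔ ¬ w.1.map ((Matrix.toLin' ((((γ : GL (Fin 3) K) : Matrix (Fin 3) (Fin 3) K) - 1) ^ 2)).restrictScalars 𝒪[K]) ≤ scaleLattice (ϖ ^ 3) w.1) := by
    intro hd; rw [hrk w, hd]; norm_num
  have hrk1' : dep w = 1 → (rk w = 1 ↔ w.1.map ((Matrix.toLin' ((((γ : GL (Fin 3) K) : Matrix (Fin 3) (Fin 3) K) - 1) ^ 2)).restrictScalars 𝒪[K]) ≤ scaleLattice (ϖ ^ 3) w.1) := by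
    intro hd; rw [hrk w, hd]; norm_num
  have hcl1 : dep w = 1 → (cl w = 1 ↔ ∃ y ∈ w.1, ∃ a : K, Valued.v a = 1 ∧ Valued.v (ϖ⁻¹ * pairing σ ((StdForm.antidiagonal 3).over K) y ((((γ : GL (Fin 3) K) : Matrix (Fin 3) (Fin 3) K) - 1) *ᵥ y) - c₁ * a ^ 2) < 1) := by
    intro hd; rw [hcl w, hd, pow_one]; norm_num
  have hcl1' : dep w = 1 → (cl w = -1 ↔ ¬ ∃ y ∈ w.1, ∃ a : K, Valued.v a = 1 ∧ Valued.v (ϖ⁻¹ * pairing σ ((StdForm.antidiagonal 3).over K) y ((((γ : GL (Fin 3) K) : Matrix (Fin 3) (Fin 3) K) - 1) *ᵥ y) - c₁ * a ^ 2) < 1) := by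
    intro hd; rw [hcl w, hd, pow_one]; norm_num
  -- ONE CLASS at a rank-one depth-one vertex (ROW-1C + ROW-N at depth 1)
  have h1C : dep w = 1 → rk w = 1 →
      ((¬ ∃ y ∈ w.1, ∃ a : K, Valued.v a = 1 ∧ Valued.v (ϖ⁻¹ * pairing σ ((StdForm.antidiagonal 3).over K) y ((((γ : GL (Fin 3) K) : Matrix (Fin 3) (Fin 3) K) - 1) *ᵥ y) - c₁ * a ^ 2) < 1) ↔
        ∃ y ∈ w.1, ∃ a : K, Valued.v a = 1 ∧ Valued.v (ϖ⁻¹ * pairing σ ((StdForm.antidiagonal 3).over K) y ((((γ : GL (Fin 3) K) : Matrix (Fin 3) (Fin 3) K) - 1) *ᵥ y) - (c₁ * ε) * a ^ 2) < 1) := by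
    intro hd hr
    have hlev1 : w.1.map ((Matrix.toLin' (((γ : GL (Fin 3) K) : Matrix (Fin 3) (Fin 3) K) - 1)).restrictScalars 𝒪[K]) ≤ scaleLattice (ϖ ^ 1) w.1 := by rw [pow_one]; exact (hd1.1 hd).1
    have hlev2 : ¬ w.1.map ((Matrix.toLin' (((γ : GL (Fin 3) K) : Matrix (Fin 3) (Fin 3) K) - 1)).restrictScalars 𝒪[K]) ≤ scaleLattice (ϖ ^ (1 + 1)) w.1 := (hd1.1 hd).2
    have hrk3 : w.1.map ((Matrix.toLin' ((((γ : GL (Fin 3) K) : Matrix (Fin 3) (Fin 3) K) - 1) ^ 2)).restrictScalars 𝒪[K]) ≤ scaleLattice (ϖ ^ (2 * 1 + 1)) w.1 := (hrk1' hd).1 hr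
    have hμ₁ : Valued.v (s 0 - 1) ≤ Valued.v ϖ ^ (1 + 1) := (heD 0).trans (pow_le_pow_right_of_le_one' hϖ1 (by omega))
    have hμ₂ : Valued.v (s 2 - 1) ≤ Valued.v ϖ ^ (1 + 1) := (heD 2).trans (pow_le_pow_right_of_le_one' hϖ1 (by omega))
    have hnil : w.1.map ((Matrix.toLin' ((((γ : GL (Fin 3) K) : Matrix (Fin 3) (Fin 3) K) - 1) ^ 3)).restrictScalars 𝒪[K]) ≤ scaleLattice (ϖ ^ (3 * 1 + 1)) w.1 := map_sub_one_pow_three_le_scaleLattice_of_charpoly_antidiagonal hϖ hγ0 (charpoly_of_eigenframe A s hs1 hγA) hμ₁ hμ₂ w hlev1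
    have h := class_xor_class_mul_of_fixed_selfDual_rankOne hσ hvσ hσϖ hϖ hres h2 hγ0 hw hfix (d := 1) le_rfl hlev1 hlev2 hrk3 hnil c₁ ε hc₁ hεv hε
    simp only [pow_one] at h
    obtain ⟨hor, hnand⟩ := h
    constructor
    · intro hn; exact hor.resolve_left hn
    · intro hε' hc; exact hnand ⟨hc, hε'⟩
  refine ⟨?_, ?_, ?_, ?_, ?_⟩
  · rw [hstr0, hd0]
  · rw [hstr1]
    constructor
    · rintro ⟨hl1, hl2, hr⟩
      have hd : dep w = 1 := hd1.2 ⟨hl1, hl2⟩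
      exact ⟨hd, (hrk1 hd).2 hr⟩
    · rintro ⟨hd, hr⟩
      exact ⟨(hd1.1 hd).1, (hd1.1 hd).2, (hrk1 hd).1 hr⟩
  · rw [hstr2]
    constructor
    · rintro ⟨hl1, hl2, hr, hc⟩
      have hd : dep w = 1 := hd1.2 ⟨hl1, hl2⟩
      exact ⟨hd, (hrk1' hd).2 hr, (hcl1 hd).2 hc⟩
    · rintro ⟨hd, hr, hc⟩
      exact ⟨(hd1.1 hd).1, (hd1.1 hd).2, (hrk1' hd).1 hr, (hcl1 hd).1 hc⟩
  · rw [hstr3]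
    constructor
    · rintro ⟨hl1, hl2, hr, hc⟩
      have hd : dep w = 1 := hd1.2 ⟨hl1, hl2⟩
      have hr' : rk w = 1 := (hrk1' hd).2 hr
      exact ⟨hd, hr', (hcl1' hd).2 ((h1C hd hr').2 hc)⟩
    · rintro ⟨hd, hr, hc⟩
      exact ⟨(hd1.1 hd).1, (hd1.1 hd).2, (hrk1' hd).1 hr, (h1C hd hr).1 ((hcl1' hd).1 hc)⟩
  · rw [hstr4, hge2]

end Literature.NumberTheory.Rogawski1990.TypeOneRamifiedJunction

end
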